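import Summits.QuantumFields.BalabanUV.T4Continuum.Spine.NE4.FadingFromRateAnalytic
import Summits.QuantumFields.BalabanUV.T4Continuum.Spine.NE4.TwoConstantsFold

/-!
# Spine/NE4/FadingFromRateRealAnalytic — the TWO-CONSTANTS rung: the REAL NE4 + analyticity in each coupling give node U2's history
# companions at EVERY rate `θ′ > θ` (loss `(age)²`) — no complex NE4, no C^{1,1} input

Cell `pub-balaban-gaps` (YM blitz G2), seat `ne4`, generation 6 (unit `pub-balaban-gaps-ne4-g6`); record `HOME/ne/NE4.md` §5 (R37).  Sequel of
`Spine/NE4/FadingFromRateAnalytic` (g5, (R34): COMPLEX NE4 `ScaleShiftRateC` + `CoordAnalyticC` ⇒ `HistLipschitz ∧ FadingMemory` at rate `θ`, by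
Cauchy's estimate) and `Spine/NE4/FadingFromRateAnalyticGap` (g5, (R36): with the REAL NE4 only, rate `θ` FAILS — witness `logFamily`, moduli
`≳ age·θ^{age}`; its header leaves the matching upper bound «`θ^{age}·O(age)` (two-constants theorem)» unformalised).  This file supplies the
upper bound, with the engine `Spine/NE4/TwoConstantsFold`.

THE POINT.  Keep g5's analyticity shape `CoordAnalyticC B γ r βc` (every one-coupling section of an extension `βc` of `β` is holomorphic near
the closed complex `r`-neighbourhood of `]0,γ]` and bounded by `B` there — printed TYPE for the last coupling, [Balaban1987RG1] p. 264 *"(or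
analytic), uniformly bounded"*) but assume NE4 ONLY in its real, typed form `T4CouplingMatching.ScaleShiftRate c θ γ β`.  NE4 caps the
oscillation of the section along the REAL box by `ε = E₀θ^{age}` (`abs_sub_le_of_agree_young'`, `E₀ = oscConst c θ B ≥ 2B`), the section is
`2B`-bounded on the neighbourhood, and for a real coupling `x ∈ ]0,γ]` one of the segments `[x, x+s]`, `[x−s, x]`, `s = min(r, γ∕2)`, lies in
the box; the ONE-SIDED two-constants bound gives `|∂β_{k+1}∕∂g_i| ≤ 2e³·ε·max(1, log(2B∕ε))²∕s ≤ K₂·θ^{a}·(1 + a·log(1∕θ))²`, `a = k − i`,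
`K₂ = 2e³E₀∕s` (§3, `abs_sub_update_le_of_realAnalytic`), whence (§4) `HistLipschitz Λ₂ γ β` with `Λ₂ k i = K₂·θ^{k−i}·(1 + (k−i)·log(1∕θ))²`
and `FadingMemory C₂(θ′) θ′ Λ₂` for EVERY `θ′ > θ`, `C₂(θ′) = K₂·max(1, 2log(1∕θ)∕log(θ′∕θ))²` (`histLipschitz_fadingMemory_of_realAnalytic`; the
polynomial `(1 + a·log(1∕θ))²` is absorbed by `pow_mul_sq_le_pow`); node U2 closes at any rate `θ′ ∈ ]θ,1[` (§5: `disc_le_of_realAnalytic`,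
`u2Inputs_of_realAnalytic`, `u2Output_of_realAnalytic`, `u2Output_under_of_realAnalytic`).  So node U2's β-side input list gains a FOURTH typed
form, the most economical one: {NE4 exactly as the spine types it (real), p. 264's analyticity-with-bound clause made uniform in the coupling
index} — at the price of the rate `θ ↦ θ′ > θ` (constant `∝ log(θ′∕θ)^{−2}`) and of two radii.

THE LADDER after this file (all kernel): C^{0,1} → no rate (`fading_needs_regularity`) · C^{1,1} → `√θ`, exact (`sqrt_rate_exact`) · analytic +
REAL NE4 → every `θ′ > θ` (this file), never `θ` itself (`not_fadingMemory_logFamily`); the polynomial loss lies between `age` (`logFamily`)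
and `age²` (this file), and `age²` is attained at the box edge by the family `θ^k·cos(ω_k·√g_0)` (recorded in NE4.md (R37); not formalised
here) · analytic + COMPLEX NE4 → `θ`, exact (`analytic_rate_exact`).

TWO RADII (honesty, as in (R29)).  `K₂ = 2e³E₀∕min(r, γᵤ∕2) ≥ 4e³E₀∕γᵤ` carries the inverse of the HYPOTHESIS box, so node U2's window
`C₂·((k₀+1)γ³ + 2γ∕b) ≤ (1−θ′)∕2` needs the RUN box `]0,γ]` small against `]0,γᵤ]` (`u2Output_under_of_realAnalytic` CHOOSES such a `γ₀`);
(R34)'s one-radius bookkeeping is special to complex NE4 — with the real NE4 the smallness segment can never be longer than the box itself.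

WHAT IS NOT CLAIMED.  That Bałaban's `β_{j+1}` admit complex couplings, any uniformity in `j` of p. 264's clause (GAPS G-adv2-3), or any
modulus in the earlier couplings (G-t4-U2-2): `CoordAnalyticC` and NE4 are HYPOTHESIS SHAPES, UNPRINTED; `B > 0` is assumed (enlarge the bound).
HONEST FRAMING: bookkeeping + elementary complex analysis over hypothesis shapes on an ABSTRACT family; nothing of Bałaban's asserted beyond
print; NE4 NOT IN PRINT, NOT PROVED; binders 0∕6, spine PROVED 0∕9 unchanged; NOT the continuum limit on ℝ⁴, NOT infinite volume, NOT a mass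
gap, NOT Clay.  HONEST DEPENDENCY: continuum YM on T⁴ ⇐ BetaPertH ∧ nine spine estimates (0∕9 proved); BetaPertH ⇐ (D1) ∧ (D4) ∧ CAP+tail.
Reference (TYPES only): [Balaban1987RG1] = T. Bałaban, Commun. Math. Phys. **109** (1987) 249–301, (0.20) p. 256, §1 p. 264, p. 298.
-/

noncomputable section

namespace Summit.QuantumFields.BalabanUV.T4Continuum.Spine.NE4

open Set Metric
open Literature.MathematicalPhysics.QuantumFieldTheory.Balaban1983to89
open Literature.MathematicalPhysics.QuantumFieldTheory.Balaban1983to89.FlowStep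
open Literature.MathematicalPhysics.QuantumFieldTheory.Balaban1983to89.T4CouplingMatching
open Literature.MathematicalPhysics.QuantumFieldTheory.Balaban1983to89.T4Continuum

universe u

/-! ## §3 Real NE4 + coordinatewise analyticity: Lipschitz moduli `K₂·θ^{age}·(1 + age·log(1∕θ))²` -/

/-- The slit length `s = min(r, γ∕2)`: a real coupling `x ∈ ]0,γ]` has `[x, x+s] ⊆ ]0,γ]` (if `x ≤ γ∕2`) or `[x−s, x] ⊆ ]0,γ]` (if
`x > γ∕2`), and the disc of radius `s` about `x` lies in `Nbhd r γ`. [folklore] -/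
def slitLen (r γ : ℝ) : ℝ := min r (γ / 2)

/-- `0 < slitLen r γ` for `r, γ > 0`. [folklore] -/
theorem slitLen_pos {r γ : ℝ} (hr : 0 < r) (hγ : 0 < γ) : 0 < slitLen r γ := lt_min hr (by linarith)

/-- The constant of the derived moduli: `K₂ = 2e³·E₀∕s`, `E₀ = oscConst c θ B`, `s = slitLen r γ`. [folklore] -/
def realAnalyticConst (c θ B r γ : ℝ) : ℝ := 2 * Real.exp 3 * oscConst c θ B / slitLen r γ

/-- `0 ≤ realAnalyticConst c θ B r γ` (`c ≥ 0`, `0 < θ < 1`, `r, γ > 0`). [folklore] -/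
theorem realAnalyticConst_nonneg {c θ B r γ : ℝ} (hc : 0 ≤ c) (hθ0 : 0 < θ) (hθ1 : θ < 1) (hr : 0 < r) (hγ : 0 < γ) :
    0 ≤ realAnalyticConst c θ B r γ := by
  have hE := oscConst_nonneg (B := B) hc hθ0 hθ1
  have hs := slitLen_pos hr hγ
  unfold realAnalyticConst
  positivity

/-- THE DERIVED MODULI `Λ₂ k i = K₂·θ^{k−i}·(1 + (k−i)·log(1∕θ))²` — geometric at NE4's rate `θ` up to the SQUARE of the age. [folklore] -/
def realAnalyticModuli (c θ B r γ : ℝ) : ℕ → ℕ → ℝ :=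
  fun k i => realAnalyticConst c θ B r γ * θ ^ (k - i) * (1 + ((k - i : ℕ) : ℝ) * (-Real.log θ)) ^ 2

/-- `0 ≤ realAnalyticModuli c θ B r γ k i`. [folklore] -/
theorem realAnalyticModuli_nonneg {c θ B r γ : ℝ} (hc : 0 ≤ c) (hθ0 : 0 < θ) (hθ1 : θ < 1) (hr : 0 < r) (hγ : 0 < γ)
    (k i : ℕ) : 0 ≤ realAnalyticModuli c θ B r γ k i :=
  mul_nonneg (mul_nonneg (realAnalyticConst_nonneg hc hθ0 hθ1 hr hγ) (pow_nonneg hθ0.le _)) (sq_nonneg _)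

/-- **COORDINATEWISE LIPSCHITZ FROM THE REAL NE4 + ANALYTICITY.**  Under `ExtendsC β βc`, the REAL `ScaleShiftRate c θ γ β` (`c ≥ 0`,
`0 < θ < 1`), `CoordAnalyticC B γ r βc` (`B, r, γ > 0`): changing the ONE coupling `g_i` of a real history in `]0,γ]^{k+1}` within `]0,γ]`
moves `β_{k+1}` by at most `K₂·θ^{a}·(1 + a·log(1∕θ))²·|Δg_i|`, `a = k − i`.  The complex section through the history in coordinate `i` is
bounded by `B` on the `r`-neighbourhood (so `‖Φ z − Φ x‖ ≤ 2B` there) and, by NE4's oscillation cap `abs_sub_le_of_agree_young'`, moves by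
`≤ ε = E₀θ^a` along the REAL box only; the one-sided two-constants bound (§2, right slit below `γ∕2`, left slit above) gives
`‖Φ′(x)‖ ≤ 2e³·ε·max(1, log(2B∕ε))²∕s ≤ K₂θ^a(1 + a·log(1∕θ))²` at every real coupling (`2B ≤ E₀`), and the mean value inequality along
the real interval concludes.  Contrast `abs_sub_update_le_of_analytic` ((R34): COMPLEX NE4, no logarithm) and
`abs_sub_update_le_of_smooth` ((R29): C^{1,1}, rate `√θ`). [folklore] -/
theorem abs_sub_update_le_of_realAnalytic {β : HBeta} {βc : HBetaC} {c θ γ r B : ℝ} (hE : ExtendsC β βc)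
    (hS : ScaleShiftRate c θ γ β) (hc : 0 ≤ c) (hθ0 : 0 < θ) (hθ1 : θ < 1) (hA : CoordAnalyticC B γ r βc) (hB : 0 < B)
    (hr : 0 < r) (hγ : 0 < γ) {k : ℕ} {p : Fin (k + 1) → ℝ} (hp : p ∈ Box γ k) (i : Fin (k + 1)) {t : ℝ}
    (ht : t ∈ Ioc (0 : ℝ) γ) :
    |β k (Function.update p i t) - β k p| ≤ realAnalyticModuli c θ B r γ k i * |t - p i| := by
  obtain ⟨U, hUo, hUsub, hdiff, hbnd⟩ := hA k p hp i
  have hbound := bound_of_coordAnalyticC hE hA hr.le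
  set a : ℕ := k - (i : ℕ) with ha
  set E₀ : ℝ := oscConst c θ B with hE₀
  have hE₀B : 2 * B ≤ E₀ := le_max_left _ _
  have hE₀pos : 0 < E₀ := lt_of_lt_of_le (by linarith) hE₀B
  set ε : ℝ := E₀ * θ ^ a with hε
  have hεpos : 0 < ε := mul_pos hE₀pos (pow_pos hθ0 a)
  set M : ℝ := max (2 * B) ε with hM
  have hεM : ε ≤ M := le_max_right _ _
  set s : ℝ := slitLen r γ with hs_def
  have hs : 0 < s := slitLen_pos hr hγ
  have hsr : s ≤ r := min_le_left _ _
  have hsγ : s ≤ γ / 2 := min_le_right _ _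
  -- the complex one-coupling section through `p` in coordinate `i`, and its real values
  let Φ : ℂ → ℂ := fun z => βc k (Function.update (fun j => (p j : ℂ)) i z)
  have hreal : ∀ u : ℝ, Φ (u : ℂ) = (β k (Function.update p i u) : ℂ) := fun u => by
    rw [← hE k (Function.update p i u)]
    show βc k _ = βc k _
    congr 1; funext j
    exact (Function.apply_update (fun _ (x : ℝ) => (x : ℂ)) p i u j).symm
  have hbox : ∀ u ∈ Ioc (0 : ℝ) γ, Function.update p i u ∈ Box γ k := fun u hu => by
    rw [mem_box] at hp ⊢
    intro j; by_cases hj : j = i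
    · subst hj; simpa using hu
    · rw [Function.update_of_ne hj]; exact hp j
  -- NE4's oscillation cap along the REAL box
  have hosc : ∀ u ∈ Ioc (0 : ℝ) γ, ∀ u' ∈ Ioc (0 : ℝ) γ, ‖Φ (u : ℂ) - Φ (u' : ℂ)‖ ≤ ε := by
    intro u hu u' hu'
    rw [hreal u, hreal u', ← Complex.ofReal_sub, Complex.norm_real, Real.norm_eq_abs]
    refine abs_sub_le_of_agree_young' hS hc hθ0 hθ1 hbound (Nat.lt_succ_iff.mp i.isLt) (hbox u hu) (hbox u' hu')
      fun j hj => ?_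
    have hji : j ≠ i := fun h => by subst h; exact lt_irrefl _ hj
    rw [Function.update_of_ne hji, Function.update_of_ne hji]
  -- the bound `M ≥ 2B` on the discs of radius `s` about real couplings, and these discs lie in `U`
  have hMdisc : ∀ x ∈ Ioc (0 : ℝ) γ, ∀ z ∈ closedBall (x : ℂ) s, ‖Φ z - Φ x‖ ≤ M := fun x hx z hz => by
    have hz' : z ∈ Nbhd r γ := mem_nbhd_of_mem_closedBall hx (closedBall_subset_closedBall hsr hz)
    calc ‖Φ z - Φ x‖ ≤ ‖Φ z‖ + ‖Φ x‖ := norm_sub_le _ _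
      _ ≤ B + B := add_le_add (hbnd z hz') (hbnd (x : ℂ) (ofReal_mem_nbhd hr.le hx))
      _ = 2 * B := by ring
      _ ≤ M := le_max_left _ _
  have hballU : ∀ x ∈ Ioc (0 : ℝ) γ, closedBall (x : ℂ) s ⊆ U := fun x hx z hz =>
    hUsub (mem_nbhd_of_mem_closedBall hx (closedBall_subset_closedBall hsr hz))
  -- the two-constants bound at every real coupling: right slit below `γ/2`, left slit above
  have hderiv : ∀ x ∈ Ioc (0 : ℝ) γ, DifferentiableAt ℂ Φ (x : ℂ) ∧
      ‖deriv Φ (x : ℂ)‖ ≤ 2 * Real.exp 3 * ε * max 1 (Real.log (M / ε)) ^ 2 / s := by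
    intro x hx
    refine ⟨hdiff.differentiableAt (hUo.mem_nhds (hballU x hx (mem_closedBall_self hs.le))), ?_⟩
    rcases le_or_gt x (γ / 2) with hxr | hxl
    · exact norm_deriv_le_of_oneSided_right hs hεpos hεM hUo (hballU x hx) hdiff (hMdisc x hx)
        fun u hxu hus => hosc u ⟨hx.1.trans_le hxu, hus.trans (by linarith)⟩ x hx
    · exact norm_deriv_le_of_oneSided_left hs hεpos hεM hUo (hballU x hx) hdiff (hMdisc x hx)
        fun u hsu hux => hosc u ⟨by linarith, hux.trans hx.2⟩ x hx
  -- the logarithm: `max(1, log(M/ε)) ≤ 1 + a·log(1/θ)` since `2B ≤ E₀`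
  have hℓ : 0 < -Real.log θ := by have := Real.log_neg hθ0 hθ1; linarith
  have hlog : Real.log (M / ε) ≤ (a : ℝ) * (-Real.log θ) := by
    rcases le_or_gt (2 * B) ε with h | h
    · rw [show M = ε from max_eq_right h, div_self hεpos.ne', Real.log_one]; positivity
    · have hq : M / ε ≤ (θ ^ a)⁻¹ := by
        rw [show M = 2 * B from max_eq_left h.le, div_le_iff₀ hεpos, hε]
        calc 2 * B ≤ E₀ := hE₀B
          _ = (θ ^ a)⁻¹ * (E₀ * θ ^ a) := by field_simp
      calc Real.log (M / ε) ≤ Real.log ((θ ^ a)⁻¹) := Real.log_le_log (div_pos (by linarith) hεpos) hq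
        _ = (a : ℝ) * (-Real.log θ) := by rw [Real.log_inv, Real.log_pow]; ring
  have hL : max 1 (Real.log (M / ε)) ≤ 1 + (a : ℝ) * (-Real.log θ) :=
    max_le (le_add_of_nonneg_right (by positivity)) (by linarith)
  have hL2 : max 1 (Real.log (M / ε)) ^ 2 ≤ (1 + (a : ℝ) * (-Real.log θ)) ^ 2 :=
    pow_le_pow_left₀ (zero_le_one.trans (le_max_left _ _)) hL 2
  have hD : ∀ x ∈ Ioc (0 : ℝ) γ, ‖deriv Φ (x : ℂ)‖ ≤ realAnalyticModuli c θ B r γ k i := fun x hx => by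
    refine (hderiv x hx).2.trans ?_
    show 2 * Real.exp 3 * ε * max 1 (Real.log (M / ε)) ^ 2 / s ≤
      2 * Real.exp 3 * E₀ / s * θ ^ a * (1 + (a : ℝ) * (-Real.log θ)) ^ 2
    have h2e : 0 ≤ 2 * Real.exp 3 * ε / s := by positivity
    calc 2 * Real.exp 3 * ε * max 1 (Real.log (M / ε)) ^ 2 / s
        = 2 * Real.exp 3 * ε / s * max 1 (Real.log (M / ε)) ^ 2 := by ring
      _ ≤ 2 * Real.exp 3 * ε / s * (1 + (a : ℝ) * (-Real.log θ)) ^ 2 := mul_le_mul_of_nonneg_left hL2 h2e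
      _ = 2 * Real.exp 3 * E₀ / s * θ ^ a * (1 + (a : ℝ) * (-Real.log θ)) ^ 2 := by rw [hε]; ring
  -- mean value inequality along the real coupling interval
  have hmvt := (convex_Ioc (0 : ℝ) γ).norm_image_sub_le_of_norm_hasDerivWithin_le
    (f := fun x : ℝ => Φ (x : ℂ)) (f' := fun x : ℝ => deriv Φ (x : ℂ))
    (fun x hx => ((hderiv x hx).1.hasDerivAt.comp_ofReal).hasDerivWithinAt)
    (fun x hx => hD x hx) ((mem_box.mp hp) i) ht
  have h2 : Φ (p i : ℂ) = (β k p : ℂ) := by rw [hreal (p i), Function.update_eq_self]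
  rw [hreal t, h2, ← Complex.ofReal_sub, Complex.norm_real, Real.norm_eq_abs, Real.norm_eq_abs] at hmvt
  exact hmvt

/-! ## §4 The headline: `HistLipschitz` and `FadingMemory` at every rate `θ′ > θ` -/

/-- **ABSORBING THE SQUARE OF THE AGE**: for `0 < θ < 1`, `θ < θ′` and every age `a`,
`θ^a·(1 + a·log(1∕θ))² ≤ max(1, 2log(1∕θ)∕log(θ′∕θ))²·θ′^a` (`1 + aℓ ≤ m·(1 + aμ∕2) ≤ m·e^{aμ∕2}`, `μ = log(θ′∕θ)`, `e^{aμ} = (θ′∕θ)^a`).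
[folklore] -/
theorem pow_mul_sq_le_pow {θ θ' : ℝ} (hθ0 : 0 < θ) (hθ1 : θ < 1) (hθθ' : θ < θ') (a : ℕ) :
    θ ^ a * (1 + (a : ℝ) * (-Real.log θ)) ^ 2 ≤ max 1 (2 * (-Real.log θ) / Real.log (θ' / θ)) ^ 2 * θ' ^ a := by
  set ℓ : ℝ := -Real.log θ with hℓ
  set μ : ℝ := Real.log (θ' / θ) with hμ
  set m : ℝ := max 1 (2 * ℓ / μ) with hm
  have hθ' : 0 < θ' := hθ0.trans hθθ'
  have hℓ0 : 0 < ℓ := by have := Real.log_neg hθ0 hθ1; rw [hℓ]; linarith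
  have hμ0 : 0 < μ := Real.log_pos (by rw [lt_div_iff₀ hθ0, one_mul]; exact hθθ')
  have hm1 : 1 ≤ m := le_max_left _ _
  have ha0 : (0 : ℝ) ≤ a := Nat.cast_nonneg a
  have h1 : 1 + (a : ℝ) * ℓ ≤ m * (1 + (a : ℝ) * μ / 2) := by
    rcases le_or_gt (2 * ℓ / μ) 1 with h | h
    · have hℓμ : ℓ ≤ μ / 2 := by rw [div_le_one hμ0] at h; linarith
      calc 1 + (a : ℝ) * ℓ ≤ 1 + (a : ℝ) * (μ / 2) := by nlinarith
        _ = 1 * (1 + (a : ℝ) * μ / 2) := by ring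
        _ ≤ m * (1 + (a : ℝ) * μ / 2) := mul_le_mul_of_nonneg_right hm1 (by positivity)
    · rw [show m = 2 * ℓ / μ from max_eq_right h.le]
      have e : 2 * ℓ / μ * (1 + (a : ℝ) * μ / 2) = 2 * ℓ / μ + (a : ℝ) * ℓ := by field_simp
      rw [e]; linarith
  have h2 : 1 + (a : ℝ) * μ / 2 ≤ Real.exp ((a : ℝ) * μ / 2) := by
    have := Real.add_one_le_exp ((a : ℝ) * μ / 2); linarith
  have h3 : Real.exp ((a : ℝ) * μ / 2) ^ 2 = (θ' / θ) ^ a := by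
    rw [← Real.exp_nat_mul, show ((2 : ℕ) : ℝ) * ((a : ℝ) * μ / 2) = (a : ℝ) * μ by push_cast; ring,
      Real.exp_nat_mul, hμ, Real.exp_log (div_pos hθ' hθ0)]
  have h4 : (1 + (a : ℝ) * ℓ) ^ 2 ≤ m ^ 2 * (θ' / θ) ^ a := by
    have h12 : 1 + (a : ℝ) * ℓ ≤ m * Real.exp ((a : ℝ) * μ / 2) :=
      h1.trans (mul_le_mul_of_nonneg_left h2 (zero_le_one.trans hm1))
    calc (1 + (a : ℝ) * ℓ) ^ 2 ≤ (m * Real.exp ((a : ℝ) * μ / 2)) ^ 2 := pow_le_pow_left₀ (by positivity) h12 2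
      _ = m ^ 2 * (θ' / θ) ^ a := by rw [mul_pow, h3]
  calc θ ^ a * (1 + (a : ℝ) * ℓ) ^ 2 ≤ θ ^ a * (m ^ 2 * (θ' / θ) ^ a) :=
        mul_le_mul_of_nonneg_left h4 (pow_nonneg hθ0.le a)
    _ = m ^ 2 * (θ * (θ' / θ)) ^ a := by rw [mul_pow]; ring
    _ = m ^ 2 * θ' ^ a := by rw [mul_div_cancel₀ _ hθ0.ne']

/-- The fading constant at rate `θ′`: `C₂(θ′) = K₂·max(1, 2log(1∕θ)∕log(θ′∕θ))²` (blows up like `(θ′ − θ)^{−2}` as `θ′ ↓ θ`). [folklore] -/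
def realAnalyticFading (c θ B r γ θ' : ℝ) : ℝ :=
  realAnalyticConst c θ B r γ * max 1 (2 * (-Real.log θ) / Real.log (θ' / θ)) ^ 2

/-- `0 ≤ realAnalyticFading c θ B r γ θ′`. [folklore] -/
theorem realAnalyticFading_nonneg {c θ B r γ : ℝ} (hc : 0 ≤ c) (hθ0 : 0 < θ) (hθ1 : θ < 1) (hr : 0 < r) (hγ : 0 < γ)
    (θ' : ℝ) : 0 ≤ realAnalyticFading c θ B r γ θ' :=
  mul_nonneg (realAnalyticConst_nonneg hc hθ0 hθ1 hr hγ) (sq_nonneg _)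

/-- **HEADLINE — FADING MEMORY FROM THE REAL NE4 + ANALYTICITY, AT EVERY RATE `θ′ > θ`.**  Under `ExtendsC β βc`, the REAL
`ScaleShiftRate c θ γ β` (`c ≥ 0`, `0 < θ < 1`), `CoordAnalyticC B γ r βc` (`B, r, γ > 0`): the moduli
`Λ₂ k i = K₂·θ^{k−i}·(1 + (k−i)·log(1∕θ))²` satisfy `HistLipschitz Λ₂ γ β`, and `FadingMemory C₂(θ′) θ′ Λ₂` for EVERY `θ′ > θ` — node U2's
two history companions DERIVED from {real NE4, coordinatewise analyticity with a bound}; NO complex NE4 (`ScaleShiftRateC`, (R34)), NO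
C^{1,1} input ((R29)); the exchange rate is `θ ↦ θ⁺` (any `θ′ > θ`, constant `∝ (θ′−θ)^{−2}`), between (R29)'s `√θ` and (R34)'s `θ`. [folklore] -/
theorem histLipschitz_fadingMemory_of_realAnalytic {β : HBeta} {βc : HBetaC} {c θ γ r B : ℝ} (hE : ExtendsC β βc)
    (hS : ScaleShiftRate c θ γ β) (hc : 0 ≤ c) (hθ0 : 0 < θ) (hθ1 : θ < 1) (hA : CoordAnalyticC B γ r βc) (hB : 0 < B)
    (hr : 0 < r) (hγ : 0 < γ) :
    HistLipschitz (realAnalyticModuli c θ B r γ) γ β ∧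
      ∀ θ', θ < θ' → FadingMemory (realAnalyticFading c θ B r γ θ') θ' (realAnalyticModuli c θ B r γ) := by
  refine ⟨histLipschitz_of_coordModuli fun k p hp i t ht =>
      abs_sub_update_le_of_realAnalytic hE hS hc hθ0 hθ1 hA hB hr hγ hp i ht, fun θ' hθθ' k i _ => ⟨?_, ?_⟩⟩
  · exact realAnalyticModuli_nonneg hc hθ0 hθ1 hr hγ k i
  · have hK := realAnalyticConst_nonneg (B := B) hc hθ0 hθ1 hr hγ
    have key := pow_mul_sq_le_pow hθ0 hθ1 hθθ' (k - i)
    show realAnalyticConst c θ B r γ * θ ^ (k - i) * (1 + ((k - i : ℕ) : ℝ) * (-Real.log θ)) ^ 2 ≤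
      realAnalyticConst c θ B r γ * max 1 (2 * (-Real.log θ) / Real.log (θ' / θ)) ^ 2 * θ' ^ (k - i)
    calc realAnalyticConst c θ B r γ * θ ^ (k - i) * (1 + ((k - i : ℕ) : ℝ) * (-Real.log θ)) ^ 2
        = realAnalyticConst c θ B r γ * (θ ^ (k - i) * (1 + ((k - i : ℕ) : ℝ) * (-Real.log θ)) ^ 2) := by ring
      _ ≤ realAnalyticConst c θ B r γ * (max 1 (2 * (-Real.log θ) / Real.log (θ' / θ)) ^ 2 * θ' ^ (k - i)) :=
          mul_le_mul_of_nonneg_left key hK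
      _ = realAnalyticConst c θ B r γ * max 1 (2 * (-Real.log θ) / Real.log (θ' / θ)) ^ 2 * θ' ^ (k - i) := by ring

/-! ## §5 Node U2 from {real NE4, analyticity} at any rate `θ′ ∈ ]θ,1[`: β-generic, and the faces on the data (two radii) -/

/-- **NODE U2 FROM THE REAL NE4 + ANALYTICITY (β-generic, two radii), AT ANY RATE `θ′ ∈ ]θ,1[`.**  The REAL NE4 `ScaleShiftRate c θ γᵤ β`
and `CoordAnalyticC B γᵤ r βc` for an extension `βc` of `β` on the box `]0,γᵤ]`; two IR-pinned runs of (0.20) in `]0,γ]`, `γ ≤ γᵤ` (A: `K`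
steps, B: `K+1` steps, `g^A_K = g^B_{K+1}`), the AF weight bound `Σ_{i≤K}(g^A_i)²g^B_{i+1} ≤ U` and the window `C₂(θ′)·U ≤ (1−θ′)∕2` give the
GEOMETRIC, K-UNIFORM matching `|1∕(g^A_j)² − 1∕(g^B_{j+1})²| ≤ (2c∕(1−θ′))·θ′^j`, `j ≤ K` — `disc_le_of_fadingMemory` at rate `θ′` with the
DERIVED moduli (`ScaleShiftRate` worsened from `θ` to `θ′`, `T4BetaReadOut.scaleShiftRate_mono`).  TWO RADII: `K₂ ≥ 2e³E₀·2∕γᵤ`, so the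
window needs `γ ≪ γᵤ` as in (R29).  Every β-side hypothesis UNPRINTED except the TYPE of the analyticity clause for the last coupling.
[cite: Balaban1987RG1, (0.20) p.256 and §1 p.264] -/
theorem disc_le_of_realAnalytic {β : HBeta} {βc : HBetaC} {c θ θ' γ γu r B U : ℝ} {K : ℕ} {gA gB : ℕ → ℝ}
    (hE : ExtendsC β βc) (hS : ScaleShiftRate c θ γu β) (hc : 0 ≤ c) (hθ0 : 0 < θ) (hθ1 : θ < 1)
    (hA : CoordAnalyticC B γu r βc) (hB : 0 < B) (hr : 0 < r) (hγu : 0 < γu) (hγle : γ ≤ γu) (hθθ' : θ < θ')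
    (hθ'1 : θ' < 1) (hAr : RGEqH K β gA) (hBr : RGEqH (K + 1) β gB)
    (hAbox : ∀ i, i ≤ K → 0 < gA i ∧ gA i ≤ γ) (hBbox : ∀ i, i ≤ K + 1 → 0 < gB i ∧ gB i ≤ γ) (hpin : gA K = gB (K + 1))
    (hU : ∑ i ∈ Finset.range (K + 1), (gA i) ^ 2 * gB (i + 1) ≤ U)
    (hsmall : realAnalyticFading c θ B r γu θ' * U ≤ (1 - θ') / 2) :
    ∀ j, j ≤ K → disc gA gB j ≤ 2 * c / (1 - θ') * θ' ^ j := by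
  obtain ⟨hL, hF⟩ := histLipschitz_fadingMemory_of_realAnalytic hE hS hc hθ0 hθ1 hA hB hr hγu
  have hθ'0 : 0 < θ' := hθ0.trans hθθ'
  have hS' := T4BetaReadOut.scaleShiftRate_mono hc hθ0.le hθθ'.le hS
  exact disc_le_of_fadingMemory hθ'0 hθ'1 hc (realAnalyticFading_nonneg hc hθ0 hθ1 hr hγu θ') hAr hBr hAbox hBbox hpin
    (fun k w hw => hS' k w (box_mono hγle (k + 1) hw))
    (fun k p q hp hq => hL k p q (box_mono hγle k hp) (box_mono hγle k hq)) (hF θ' hθθ') hU hsmall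

variable {F : T4Family} {G : Type u} [GaugeGroup G] [MeasurableSpace G] [HaarData G]

/-- **ON THE DATA: NODE U2's INPUT TRIPLE FROM THE REAL NE4 + ANALYTICITY, AT ANY RATE `θ′ > θ`.**  An extension `βc` of `D.βfun` with
`CoordAnalyticC B γᵤ r βc`, together with NE4 FOR THE DATA `NE4OnData D c θ γᵤ` (real, as typed in `Spine/NE4/Targets`), gives
`U2Inputs D c C₂(θ′) θ′ γᵤ Λ₂` for every `θ′ > θ` — both history companions DERIVED, no complex NE4, no C^{1,1}. [folklore] -/
theorem u2Inputs_of_realAnalytic (D : FiniteEpsData F G) {βc : HBetaC} {c θ θ' γu r B : ℝ} (hE : ExtendsC D.βfun βc)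
    (hN : NE4OnData D c θ γu) (hc : 0 ≤ c) (hθ0 : 0 < θ) (hθ1 : θ < 1) (hA : CoordAnalyticC B γu r βc) (hB : 0 < B)
    (hr : 0 < r) (hγu : 0 < γu) (hθθ' : θ < θ') :
    U2Inputs D c (realAnalyticFading c θ B r γu θ') θ' γu (realAnalyticModuli c θ B r γu) := by
  obtain ⟨hL, hF⟩ := histLipschitz_fadingMemory_of_realAnalytic hE hN hc hθ0 hθ1 hA hB hr hγu
  exact ⟨T4BetaReadOut.scaleShiftRate_mono hc hθ0.le hθθ'.le hN, hL, hF θ' hθθ'⟩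

/-- **ON THE DATA: NODE U2's OUTPUT FROM THE REAL NE4 + ANALYTICITY (two radii), AT ANY RATE `θ′ ∈ ]θ,1[`.**  With the extension's
analyticity shape and NE4 for the data on `]0,γᵤ]`, a run box `]0,γ]`, `γ ≤ γᵤ`, the AF binders `EventualLowerH b γ k₀` (`b > 0`) and
`BetaUpperH β′ γ` (`γ²β′ < 1`), a sequence `g₀` TUNED to `g` within `]0,γ]`, and the window `C₂(θ′)·((k₀+1)γ³ + 2γ∕b) ≤ (1−θ′)∕2`:
`U2Output D g₀ (2c∕(1−θ′)) θ′` — node U6's typed source, geometric and K-uniform, from {real NE4, analyticity}. [folklore] -/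
theorem u2Output_of_realAnalytic (D : FiniteEpsData F G) {βc : HBetaC} {c θ θ' γ γu r B b β' g : ℝ} {k₀ : ℕ} {g₀ : ℕ → ℝ}
    (hE : ExtendsC D.βfun βc) (hN : NE4OnData D c θ γu) (hc : 0 ≤ c) (hθ0 : 0 < θ) (hθ1 : θ < 1)
    (hA : CoordAnalyticC B γu r βc) (hB : 0 < B) (hr : 0 < r) (hγu : 0 < γu) (hγ : 0 < γ) (hγle : γ ≤ γu)
    (hθθ' : θ < θ') (hθ'1 : θ' < 1) (hb : 0 < b) (hlo : EventualLowerH b γ k₀ D.βfun) (hhi : BetaUpperH β' γ D.βfun)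
    (hγβ : γ ^ 2 * β' < 1) (ht : D.Tuned γ g g₀)
    (hsmall : realAnalyticFading c θ B r γu θ' * (((k₀ : ℝ) + 1) * γ ^ 3 + 2 * γ / b) ≤ (1 - θ') / 2) :
    U2Output D g₀ (2 * c / (1 - θ')) θ' :=
  u2Output_of_u2Inputs D ((u2Inputs_of_realAnalytic D hE hN hc hθ0 hθ1 hA hB hr hγu hθθ').mono hγle) hγ hb
    (hθ0.trans hθθ') hθ'1 hc (realAnalyticFading_nonneg hc hθ0 hθ1 hr hγu θ') hlo hhi hγβ ht hsmall

/-- **NO WINDOW BINDER** (the `FiniteEpsData.UnderHypotheses` face, cf. `u2Output_under_of_smooth` ∕ `u2Output_under_of_analytic`): with the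
analyticity shape, NE4 for the data and the AF binders on ONE hypothesis box `]0,γᵤ]` (`EventualLowerH b γᵤ k₀`, `BetaUpperH β′ γᵤ`,
`γᵤ²β′ < 1`) and a rate `θ′ ∈ ]θ,1[`, node U2's output `U2Output D g₀ (2c∕(1−θ′)) θ′` holds for EVERY run box
`γ ≤ γ₀ := min(γᵤ, 1, ((1−θ′)∕2)∕((C₂(θ′)+1)((k₀+1)+2∕b)))`, every `g` and every sequence tuned to `g` within `]0,γ]` — the run box is
CHOSEN (`window_of_small_box`), nothing is assumed small; two radii (`γ₀ < γᵤ` in general). [folklore] -/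
theorem u2Output_under_of_realAnalytic (D : FiniteEpsData F G) {Hβ : Prop} {βc : HBetaC} {c θ θ' γu r B b β' : ℝ}
    {k₀ : ℕ} (hE : ExtendsC D.βfun βc) (hN : NE4OnData D c θ γu) (hc : 0 ≤ c) (hθ0 : 0 < θ) (hθ1 : θ < 1)
    (hA : CoordAnalyticC B γu r βc) (hB : 0 < B) (hr : 0 < r) (hγu : 0 < γu) (hθθ' : θ < θ') (hθ'1 : θ' < 1)
    (hb : 0 < b) (hlo : EventualLowerH b γu k₀ D.βfun) (hhi : BetaUpperH β' γu D.βfun) (hγβ : γu ^ 2 * β' < 1) :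
    D.UnderHypotheses Hβ fun g₀ => U2Output D g₀ (2 * c / (1 - θ')) θ' := by
  intro _ _
  set C₁ : ℝ := realAnalyticFading c θ B r γu θ' with hC₁
  have hC : 0 ≤ C₁ := realAnalyticFading_nonneg hc hθ0 hθ1 hr hγu θ'
  have hW : 0 < (1 - θ') / 2 := by linarith
  set γ₀ : ℝ := min γu (min 1 ((1 - θ') / 2 / ((C₁ + 1) * (((k₀ : ℝ) + 1) + 2 / b)))) with hγ₀
  have hγ₀pos : 0 < γ₀ := lt_min hγu (lt_min one_pos (by positivity))
  refine ⟨γ₀, hγ₀pos, fun γ hγ hγle => ⟨1, one_pos, fun g _ _ g₀ ht => ?_⟩⟩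
  have hγu' : γ ≤ γu := hγle.trans (min_le_left _ _)
  have hγ1 : γ ≤ 1 := hγle.trans ((min_le_right _ _).trans (min_le_left _ _))
  have hγW : γ ≤ (1 - θ') / 2 / ((C₁ + 1) * (((k₀ : ℝ) + 1) + 2 / b)) :=
    hγle.trans ((min_le_right _ _).trans (min_le_right _ _))
  have hsmall := window_of_small_box (k₀ := k₀) hC hb hW hγ.le hγ1 hγW
  exact u2Output_of_realAnalytic D hE hN hc hθ0 hθ1 hA hB hr hγu hγ hγu' hθθ' hθ'1 hb
    (fun k v hk hv => hlo k v hk (box_mono hγu' k hv)) (fun k v hv => hhi k v (box_mono hγu' k hv))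
    (sq_mul_lt_one_mono hγ hγu' hγβ) ht hsmall


/-! ## §6 (v1.1) Upstream: node U2's triple from NE5 + the read-out (R) + analyticity — no complex NE4, no NE9, no U3 fading memory -/

/-- **NODE U2's TRIPLE ON THE DATA FROM NE5 + (R) + ANALYTICITY, AT ANY RATE `θ′ > θ`** (the real-analytic twin of `u2Inputs_of_ne5_smooth`):
the η-rate of `β` (the REAL NE4 for the data, `ScaleShiftRate (cr·C₅·θ) θ γᵤ D.βfun`) comes from NE5 for every unpaired coupling `b` and the
covariant read-out (`T4BetaReadOutLipschitz.scaleShiftRate_of_ne5_on`, BY NAME); BOTH history companions — the moduli AND their decay at any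
`θ′ > θ` — come from the analyticity-with-bound shape `CoordAnalyticC B γᵤ r βc` of an extension `βc` of `D.βfun` by
`histLipschitz_fadingMemory_of_realAnalytic`.  So row NE4's node-U2 triple ⇐ row NE5 + (R) + p. 264's analyticity clause made uniform in the
coupling index; row NE9 and node U3's `FadingMemory` are NOT inputs, and NE4 is never asked for complex couplings.  Every input UNPRINTED
(NE5: GAPS G-t4-U3-1; (R): dischargeable on analytic slices; analyticity for `i < k`: G-t4-U2-2). [folklore] -/
theorem u2Inputs_of_ne5_realAnalytic (D : FiniteEpsData F G) {C : T4OutputRate.Carriers} {W : Set (ℕ → ℝ)}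
    {EA : T4OutputRate.Functional C C.BgA} {EB : ℝ → T4OutputRate.Functional C C.BgB}
    {𝒜A : Set (T4BetaReadOut.Slice C C.BgA)} {𝒜B : Set (T4BetaReadOut.Slice C C.BgB)} {rA : T4BetaReadOut.ReadOut C C.BgA}
    {rB : T4BetaReadOut.ReadOut C C.BgB} {βc : HBetaC} {γu κ θ θ' C₅ cr r B : ℝ}
    (hW : ∀ k (v : Fin (k + 1) → ℝ), v ∈ Box γu k → T4FlagMemory.extd v ∈ W)
    (h5 : ∀ b, 0 < b → b ≤ γu → T4OutputRate.NE5 EA (EB b) W κ θ C₅) (hA : T4BetaReadOut.RepresentsA EA rA γu D.βfun)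
    (hB : T4BetaReadOut.RepresentsB EB rB γu D.βfun) (h𝒜A : ∀ g ∈ W, EA g ∈ 𝒜A)
    (h𝒜B : ∀ b, 0 < b → b ≤ γu → ∀ g ∈ W, EB b g ∈ 𝒜B) (hcov : T4BetaReadOutLipschitz.ReadCovariantOn 𝒜A 𝒜B rA rB κ cr)
    (hcr : 0 ≤ cr) (hC₅ : 0 ≤ C₅) (hθ0 : 0 < θ) (hθ1 : θ < 1) (hE : ExtendsC D.βfun βc) (hAn : CoordAnalyticC B γu r βc)
    (hBpos : 0 < B) (hr : 0 < r) (hγu : 0 < γu) (hθθ' : θ < θ') :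
    U2Inputs D (cr * C₅ * θ) (realAnalyticFading (cr * C₅ * θ) θ B r γu θ') θ' γu (realAnalyticModuli (cr * C₅ * θ) θ B r γu) :=
  u2Inputs_of_realAnalytic D hE (T4BetaReadOutLipschitz.scaleShiftRate_of_ne5_on hW h5 hA hB h𝒜A h𝒜B hcov)
    (mul_nonneg (mul_nonneg hcr hC₅) hθ0.le) hθ0 hθ1 hAn hBpos hr hγu hθθ'


/-- **END TO END (v1.2): NODE U2's OUTPUT UNDER THE TARGETS' PREFIX ⇐ NE5 + (R) + ANALYTICITY + THE AF BINDERS** — the kernel form of row NE4's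
«DEPENDENT» status at node U2 with the fewest β-side inputs: NE5 for every unpaired coupling and the covariant read-out (R) give the REAL NE4 for the data
(`scaleShiftRate_of_ne5_on`), the analyticity-with-bound shape of an extension of `D.βfun` gives both history companions at any `θ′ > θ`
(`u2Inputs_of_ne5_realAnalytic`), and with the AF binders on the hypothesis box (`EventualLowerH b γᵤ k₀`, `BetaUpperH β′ γᵤ`, `γᵤ²β′ < 1`) node U2's
geometric K-uniform output `U2Output D g₀ (2·cr·C₅·θ∕(1−θ′)) θ′` holds for every run box `γ ≤ γ₀`, every `g`, every tuned `g₀` — NO NE9, NO U3 fading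
memory, NO complex NE4∕NE5, NO window binder (`u2Output_under_of_realAnalytic`).  Every input UNPRINTED except TYPES. [folklore] -/
theorem u2Output_under_of_ne5_realAnalytic (D : FiniteEpsData F G) {Hβ : Prop} {C : T4OutputRate.Carriers} {W : Set (ℕ → ℝ)}
    {EA : T4OutputRate.Functional C C.BgA} {EB : ℝ → T4OutputRate.Functional C C.BgB}
    {𝒜A : Set (T4BetaReadOut.Slice C C.BgA)} {𝒜B : Set (T4BetaReadOut.Slice C C.BgB)} {rA : T4BetaReadOut.ReadOut C C.BgA}
    {rB : T4BetaReadOut.ReadOut C C.BgB} {βc : HBetaC} {γu κ θ θ' C₅ cr r B b β' : ℝ} {k₀ : ℕ}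
    (hW : ∀ k (v : Fin (k + 1) → ℝ), v ∈ Box γu k → T4FlagMemory.extd v ∈ W)
    (h5 : ∀ b, 0 < b → b ≤ γu → T4OutputRate.NE5 EA (EB b) W κ θ C₅) (hA : T4BetaReadOut.RepresentsA EA rA γu D.βfun)
    (hB : T4BetaReadOut.RepresentsB EB rB γu D.βfun) (h𝒜A : ∀ g ∈ W, EA g ∈ 𝒜A)
    (h𝒜B : ∀ b, 0 < b → b ≤ γu → ∀ g ∈ W, EB b g ∈ 𝒜B) (hcov : T4BetaReadOutLipschitz.ReadCovariantOn 𝒜A 𝒜B rA rB κ cr)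
    (hcr : 0 ≤ cr) (hC₅ : 0 ≤ C₅) (hθ0 : 0 < θ) (hθ1 : θ < 1) (hE : ExtendsC D.βfun βc) (hAn : CoordAnalyticC B γu r βc)
    (hBpos : 0 < B) (hr : 0 < r) (hγu : 0 < γu) (hθθ' : θ < θ') (hθ'1 : θ' < 1) (hb : 0 < b) (hlo : EventualLowerH b γu k₀ D.βfun)
    (hhi : BetaUpperH β' γu D.βfun) (hγβ : γu ^ 2 * β' < 1) :
    D.UnderHypotheses Hβ fun g₀ => U2Output D g₀ (2 * (cr * C₅ * θ) / (1 - θ')) θ' :=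
  u2Output_under_of_realAnalytic D hE (T4BetaReadOutLipschitz.scaleShiftRate_of_ne5_on hW h5 hA hB h𝒜A h𝒜B hcov)
    (mul_nonneg (mul_nonneg hcr hC₅) hθ0.le) hθ0 hθ1 hAn hBpos hr hγu hθθ' hθ'1 hb hlo hhi hγβ

end Summit.QuantumFields.BalabanUV.T4Continuum.Spine.NE4

end
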